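import Mathlib.Data.Finset.NatAntidiagonal
import Literature.NumberTheory.Transcendental.DeRhamTheorem
import Literature.NumberTheory.Transcendental.KaehlerHodge
import Literature.NumberTheory.Transcendental.Dolbeault
import Literature.NumberTheory.Transcendental.ComplexForms
import Literature.Geometry.Kaehler.Kaehler
import Literature.AlgebraicTopology.SingularHomology.SingularCochains
import Literature.AlgebraicTopology.SingularHomology.PoincareDuality
import HarnessLib

-- provenance: harness21/H21/H21/Statements/Hodge/DeRhamComparison.lean @ 585521a (interim HEAD d8f2665); M5 mechanical rewrite
/-!
# Comparison of singular and analytic de Rham cohomology; Hodge-to-de Rham degeneration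

Trunk: TranscendKaehlerL (`H21/Outlines/TranscendKaehlerL.md`, §3, item `DeRhamComparisonStmt`);
family `hodge`; notions `de_rham_cohomology_manifold`, `dolbeault_cohomology`,
`harmonic_forms_laplacian`; statement id **hodge.S18**.

The inventory statement **hodge.S18** is the chain of comparison isomorphisms
"singular cohomology of `X(ℂ)` with `ℂ`-coefficients = analytic de Rham cohomology = holomorphic
de Rham hypercohomology = algebraic de Rham cohomology (Grothendieck 1966, Thm. 1'), together
with the degeneration of the Hodge-to-de Rham spectral sequence at `E₁` (Deligne–Illusie 1987
for the algebraic proof)". This file states its **analytic slice** for a compact complex manifold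
`M` charted on a finite-dimensional complex normed space `E`:

* de Rham's theorem with complex coefficients, `H^k_dR(M; ℂ) ≃ₗ[ℂ] H^k(M; ℂ)` naturally in `M`
  (de Rham 1931; Weil 1952), and `dim_ℂ H^k_dR(M; ℂ) = b_k(M; ℂ)` are the named facts
  `Literature.NumberTheory.Transcendental.exists_complexDeRhamIsoFamily` / `Literature.NumberTheory.Transcendental.finrank_complexDeRham_eq_bettiNumber` of
  `Literature/NumberTheory/Transcendental/DeRhamTheorem` (not restated here; the former local
  names survive as deprecated aliases); the pointwise corollary
  `Literature.AlgebraicGeometry.Motives.nonempty_complexDeRhamCohomology_equiv_singularCohomology` is a theorem conditional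
  on the first fact;
* `Literature.AlgebraicGeometry.Motives.sum_hodgeNumber_eq_bettiNumber`: **Hodge-to-de Rham degeneration, numerical form**
  for compact Kähler `M`: `∑_{p+q=k} h^{p,q}(M) = b_k(M)` (Hodge 1941; Voisin (2002), §6.1.3;
  Deligne–Illusie (1987) for smooth projective varieties by reduction mod `p`), a named fact,
  with the conditional theorem `sum_hodgeNumber_eq_bettiNumber_of` deriving it from
  `Literature.NumberTheory.Transcendental.sum_hodgeNumber_eq_finrank_complexDeRham` and `Literature.NumberTheory.Transcendental.finrank_complexDeRham_eq_bettiNumber`;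
* `Literature.AlgebraicGeometry.Motives.bettiNumber_le_sum_hodgeNumber`: the **Frölicher inequality**
  `b_k(M) ≤ ∑_{p+q=k} h^{p,q}(M)` for an arbitrary compact complex manifold (Frölicher 1955),
  i.e. the numerical shadow of the Frölicher (Hodge-to-de Rham) spectral sequence
  `E₁^{p,q} = H^{p,q}_{∂̄}(M) ⟹ H^{p+q}_dR(M; ℂ)`; equality in all degrees is degeneration at `E₁`
  (named fact), with the conditional theorem `bettiNumber_le_sum_hodgeNumber_of` deriving it from
  its analytic core `Literature.AlgebraicGeometry.Motives.finrank_complexDeRham_le_sum_hodgeNumber`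
  (`dim_ℂ H^k_dR(M; ℂ) ≤ ∑_{p+q=k} h^{p,q}(M)`, Voisin (2002), §8.3.3, pp. 204–205; named fact)
  and `Literature.NumberTheory.Transcendental.finrank_complexDeRham_eq_bettiNumber`.

The remaining members of S18 — the holomorphic de Rham hypercohomology `ℍ^k(M, Ω^•_M)` and
Grothendieck's algebraic de Rham comparison `H^k_dR(X/ℂ) ≅ H^k(X(ℂ); ℂ)` for a smooth complex
algebraic variety `X` — need the notion `algebraic_de_rham_cohomology` (and `analytification`)
of trunk T-MOTIVE and are **not** stated here.

## Betti numbers: homological versus cohomological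

G04's `Literature.bettiNumber ℂ M k = finrank ℂ Hₖ(M; ℂ)` is the rank of singular *homology*, whereas
the de Rham comparison lands in singular *cohomology* `Literature.singularCohomology ℂ ℂ M k`. Over the
field `ℂ` the universal coefficient theorem gives `Hᵏ(M; ℂ) ≅ Hom_ℂ(Hₖ(M; ℂ), ℂ)` (Hatcher
(2002), Thm. 3.2), and `Hₖ(M; ℂ)` is finite-dimensional for compact `M` (Hatcher, Cor. A.8–A.9),
so the two ranks agree; the equalities with `bettiNumber` below are the intended ones.

## Mathlib status (pinned v4.32.0)

Mathlib has neither de Rham cohomology of manifolds, nor singular (co)homology of spaces with a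
comparison, nor Dolbeault cohomology / Hodge numbers (searched: `deRham`, `Dolbeault`,
`hodgeNumber`, `bettiNumber`, `Frolicher`); all objects come from the H21 preludes
(`DeRhamTheorem`, `ComplexForms`, `Dolbeault`, `KaehlerHodge`, G21 `Kaehler`, G04
`PoincareDuality`). From Mathlib we use `Finset.antidiagonal` and `Module.finrank`.

## Design notes

* Setting: `E : Type` (universe `0`, forced by `Literature.ComplexDeRhamIsoFamily E : Type 1`, whose
  members are indexed by manifolds in the universe of `E`; see the universe discussion in
  `DeRhamTheorem`), `M : Type` a compact Hausdorff complex manifold,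
  `[IsManifold 𝓘(ℂ, E) ω M] [IsManifold 𝓘(ℝ, E) ∞ M]` (the real-smooth structure is what forms
  and de Rham cohomology consume; Mathlib does not derive it from the holomorphic one). The two
  de Rham comparison statements are placed before `[IsManifold 𝓘(ℂ, E) ω M]` enters the
  section, since they only use the real-smooth structure.
* D-0014: the prelude results `exists_complexDeRhamIsoFamily`,
  `finrank_complexDeRham_eq_bettiNumber` and `sum_hodgeNumber_eq_finrank_complexDeRham` are named
  facts (`def X : Prop`), so the statements here are theorems taking them as hypotheses
  (`…_of`); the two numerical statements are named facts of their own, with the compactness /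
  manifold instances bound *inside* the `Prop` (a `def … : Prop` drops unused section
  instances).  The file is `sorry`-free.
* The Kähler hypothesis of `sum_hodgeNumber_eq_bettiNumber` is G21's `[IsKaehlerManifold E M]`
  (existence of some smooth Kähler metric); Hodge and Betti numbers are metric-free.

## References

* G. de Rham, *Sur l'analysis situs des variétés à n dimensions*, J. Math. Pures Appl. 10 (1931).
* A. Weil, *Sur les théorèmes de de Rham*, Comment. Math. Helv. 26 (1952), 119–145
  (`WeilCMH1952`).
* W. V. D. Hodge, *The Theory and Applications of Harmonic Integrals*, Cambridge Univ. Press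
  (1941), Ch. IV (`HodgeHarmonicIntegrals1941`).
* A. Frölicher, *Relations between the cohomology groups of Dolbeault and topological
  invariants*, Proc. Nat. Acad. Sci. USA 41 (1955), 641–644 (`FrolicherPNAS1955`).
* R. O. Wells, *Differential Analysis on Complex Manifolds*, GTM 65 (1980), Thm. III.4.13
  (`WellsDACM1980`).
* A. Grothendieck, *On the de Rham cohomology of algebraic varieties*, Publ. Math. IHÉS 29
  (1966), Thm. 1'.
* P. Deligne, L. Illusie, *Relèvements modulo `p²` et décomposition du complexe de de Rham*,
  Invent. Math. 89 (1987), 247–270, Cor. 2.7.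
* C. Voisin, *Hodge Theory and Complex Algebraic Geometry I* (2002), §6.1.3; §8.3.3, Thm. 8.28
  and Rem. 8.29, pp. 204–205 (Frölicher spectral sequence) (`VoisinHodgeI2002`).
* D. Huybrechts, *Complex Geometry* (2005), Cor. 3.2.12, Ex. 3.2.11 (`HuybrechtsCG2005`).
* A. Hatcher, *Algebraic Topology* (2002), Thm. 3.2, Cor. A.8–A.9 (`HatcherAT2002`).
-/

noncomputable section

open scoped Manifold ContDiff
open Module Finset

namespace Literature.AlgebraicGeometry.Motives

section Hodge

variable (E : Type) [NormedAddCommGroup E] [NormedSpace ℂ E] [FiniteDimensional ℂ E]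
variable (M : Type) [TopologicalSpace M] [ChartedSpace E M]
  [IsManifold 𝓘(ℝ, E) ∞ M] [CompactSpace M] [T2Space M]

/-! ### Singular cohomology with `ℂ`-coefficients = analytic de Rham cohomology -/

/-- **hodge.S18** (analytic slice): de Rham's theorem with complex coefficients, natural in `M`,
is the named fact `Literature.NumberTheory.Transcendental.exists_complexDeRhamIsoFamily` of
`Literature/NumberTheory/Transcendental/DeRhamTheorem` (universe `0`); the old local name is kept
as a deprecated alias only. [cite: WellsDACM1980, Thm. III.4.13] -/
@[deprecated Literature.NumberTheory.Transcendental.exists_complexDeRhamIsoFamily (since := "2026-08-13")]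
alias exists_complexDeRhamIso_natural := Literature.NumberTheory.Transcendental.exists_complexDeRhamIsoFamily

/-- **hodge.S18** (pointwise corollary). For a compact complex manifold `M` (only its
real-smooth structure is used) the complex de Rham
cohomology and the singular cohomology with complex coefficients are isomorphic `ℂ`-vector
spaces, `H^k_dR(M; ℂ) ≃ₗ[ℂ] H^k(M; ℂ)` (de Rham 1931; Weil 1952; Voisin (2002), §6.1.1; Wells
(1980), Thm. III.4.13), conditional on the named fact `Literature.exists_complexDeRhamIsoFamily E`.
Consumers needing naturality should use that fact directly.
[cite: WellsDACM1980, Thm. III.4.13] -/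
theorem nonempty_complexDeRhamCohomology_equiv_singularCohomology
    (h : Literature.NumberTheory.Transcendental.exists_complexDeRhamIsoFamily E) (k : ℕ) :
    Nonempty (Literature.NumberTheory.Transcendental.complexDeRhamCohomology E M k ≃ₗ[ℂ] Literature.AlgebraicTopology.SingularHomology.singularCohomology ℂ ℂ M k) := by
  obtain ⟨e, -⟩ := h
  exact ⟨e M k⟩

/-- **hodge.S18** (Betti numbers via analytic de Rham cohomology), `dim_ℂ H^k_dR(M; ℂ) = b_k(M; ℂ)`,
is the named fact `Literature.NumberTheory.Transcendental.finrank_complexDeRham_eq_bettiNumber` of `DeRhamTheorem` (G04's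
homological `bettiNumber` agrees with the cohomological rank over the field `ℂ` by universal
coefficients, Hatcher (2002), Thm. 3.2, Cor. A.8–A.9); the old local name is kept as a
deprecated alias only. [cite: HatcherAT2002, Thm. 3.2 / Cor. A.8–A.9] -/
@[deprecated Literature.NumberTheory.Transcendental.finrank_complexDeRham_eq_bettiNumber (since := "2026-08-13")]
alias finrank_complexDeRhamCohomology_eq_bettiNumber := Literature.NumberTheory.Transcendental.finrank_complexDeRham_eq_bettiNumber

/-! ### Hodge-to-de Rham degeneration, numerically

The two comparison statements above only use the real-smooth structure of `M`; from here on `M`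
is a complex manifold. -/

variable [IsManifold 𝓘(ℂ, E) ω M]

/-- **hodge.S18** (Hodge-to-de Rham degeneration at `E₁`, numerical form, compact Kähler case).
For a compact Kähler manifold `M`, `∑_{p+q=k} h^{p,q}(M) = b_k(M; ℂ)`: the Frölicher spectral
sequence `E₁^{p,q} = H^{p,q}_{∂̄}(M) ⟹ H^{p+q}_dR(M; ℂ)` degenerates at `E₁` (equivalently, the
Frölicher inequality `bettiNumber_le_sum_hodgeNumber` is an equality in every degree). Analytic
proof: Hodge decomposition via harmonic forms (Hodge 1941; Voisin (2002), §6.1.3, Thm. 8.28;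
Huybrechts (2005), Cor. 3.2.12); algebraic proof for smooth projective varieties:
Deligne–Illusie, Invent. Math. 89 (1987), Cor. 2.7.  Named fact; derived from the named facts
`Literature.NumberTheory.Transcendental.sum_hodgeNumber_eq_finrank_complexDeRham` and `Literature.NumberTheory.Transcendental.finrank_complexDeRham_eq_bettiNumber` by
`sum_hodgeNumber_eq_bettiNumber_of`. [cite: VoisinHodgeI2002, §6.1.3]
[cite: HodgeHarmonicIntegrals1941, Ch. IV] -/
def sum_hodgeNumber_eq_bettiNumber : Prop :=
  ∀ [CompactSpace M] [T2Space M] [Literature.Geometry.Kaehler.IsKaehlerManifold E M] (k : ℕ),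
    ∑ pq ∈ antidiagonal k, Literature.NumberTheory.Transcendental.hodgeNumber E M pq.1 pq.2 = Literature.AlgebraicTopology.SingularHomology.bettiNumber ℂ M k

/-- `sum_hodgeNumber_eq_bettiNumber` follows from the numerical Hodge decomposition
`∑_{p+q=k} h^{p,q} = dim_ℂ H^k_dR(M; ℂ)` for a Kähler metric
(`Literature.NumberTheory.Transcendental.sum_hodgeNumber_eq_finrank_complexDeRham`) and de Rham's theorem
`dim_ℂ H^k_dR(M; ℂ) = b_k(M; ℂ)` (`Literature.NumberTheory.Transcendental.finrank_complexDeRham_eq_bettiNumber`): the interim proof,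
with the two named facts threaded as hypotheses. [cite: VoisinHodgeI2002, §6.1.3] -/
theorem sum_hodgeNumber_eq_bettiNumber_of
    (hH : ∀ g : Bundle.ContMDiffRiemannianMetric 𝓘(ℝ, E) ∞ E
      (fun x : M ↦ TangentSpace 𝓘(ℝ, E) x),
      Literature.NumberTheory.Transcendental.sum_hodgeNumber_eq_finrank_complexDeRham g)
    (hdR : ∀ k, Literature.NumberTheory.Transcendental.finrank_complexDeRham_eq_bettiNumber E M k) :
    sum_hodgeNumber_eq_bettiNumber E M := by
  intro _ _ _ k
  obtain ⟨g, hg⟩ := Literature.Geometry.Kaehler.IsKaehlerManifold.exists_isKaehler (E := E) (M := M)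
  rw [← show finrank ℂ (Literature.NumberTheory.Transcendental.complexDeRhamCohomology E M k) = Literature.AlgebraicTopology.SingularHomology.bettiNumber ℂ M k from hdR k]
  exact hH g hg k

/-- **hodge.S18** (Frölicher inequality). For an arbitrary compact complex manifold `M`,
`b_k(M; ℂ) ≤ ∑_{p+q=k} h^{p,q}(M)`: the abutment `H^k_dR(M; ℂ)` of the Frölicher
(Hodge-to-de Rham) spectral sequence is a subquotient of `⨁_{p+q=k} E₁^{p,q} = ⨁ H^{p,q}_{∂̄}(M)`,
and both sides are finite-dimensional for compact `M` (Cartan–Serre). Equality in all degrees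
holds iff the spectral sequence degenerates at `E₁` (e.g. for Kähler `M`,
`sum_hodgeNumber_eq_bettiNumber`); it fails e.g. for the Iwasawa manifold. Frölicher, Proc. Nat.
Acad. Sci. 41 (1955); Voisin (2002), §8.3.3, proof of Thm. 8.28 and Rem. 8.29 (pp. 204–205:
"`E_∞^{p,q}` can be identified with a quotient of a subspace of `E_1^{p,q} = H^q(X, Ω^p_X)`",
"`dim E_i^{p,q} ≤ dim E_{i-1}^{p,q}`", and Rem. 8.29: degeneracy at `E₁` is equivalent to
"`b_k = ∑_{p+q=k} h^{p,q}`, where `b_k = dim H^k(X, ℂ)` and `h^{p,q}(X) = dim H^q(X, Ω^p_X)`";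
`H^q(X, Ω^p_X) = H^{p,q}_{∂̄}(X)` by Voisin's Cor. 4.38); Huybrechts (2005), Ex. 3.2.11;
Griffiths–Harris (1978), p. 444.  Named fact (D-0014); the instance hypotheses are bound inside
the `Prop` so that the fact cannot be instantiated at a non-compact `M`.  Derived from the
analytic core `finrank_complexDeRham_le_sum_hodgeNumber` (below) and de Rham's theorem
`Literature.NumberTheory.Transcendental.finrank_complexDeRham_eq_bettiNumber` by `bettiNumber_le_sum_hodgeNumber_of`; an
unconditional proof needs de Rham's theorem, Cartan–Serre finiteness
(`Literature.NumberTheory.Transcendental.finite_dolbeaultCohomology`) and the Frölicher spectral sequence, none of which is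
proved in the tree (triage XL, session 2026-08-14).
[cite: VoisinHodgeI2002, §8.3.3, proof of Thm. 8.28 and Rem. 8.29, pp. 204–205]
[cite: FrolicherPNAS1955, §2] -/
def bettiNumber_le_sum_hodgeNumber : Prop :=
  ∀ [FiniteDimensional ℂ E] [IsManifold 𝓘(ℝ, E) ∞ M] [IsManifold 𝓘(ℂ, E) ω M]
    [CompactSpace M] [T2Space M] (k : ℕ),
    Literature.AlgebraicTopology.SingularHomology.bettiNumber ℂ M k ≤ ∑ pq ∈ antidiagonal k, Literature.NumberTheory.Transcendental.hodgeNumber E M pq.1 pq.2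

/-- **Frölicher inequality, analytic core** (de Rham side). For a compact Hausdorff complex
manifold `M`, `dim_ℂ H^k_dR(M; ℂ) ≤ ∑_{p+q=k} h^{p,q}(M)`.  This is the content of the argument
printed in Voisin (2002), §8.3.3, pp. 204–205 (proof of Thm. 8.28, valid for any compact complex
manifold before the Kähler hypothesis enters): the Frölicher spectral sequence of the filtered
de Rham complex `(A^•(M), d)`, `F^p A^k = ⨁_{r ≥ p, r+s=k} A^{r,s}`, has
`E_1^{p,q} = H^q(A^{p,•}(M), ∂̄) = H^{p,q}_{∂̄}(M)` (Prop. 8.25) and abuts to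
`Gr^p_F H^{p+q}(A^•(M), d) = Gr^p_F H^{p+q}_dR(M; ℂ) = E_∞^{p,q}`, "a quotient of a subspace of
`E_1^{p,q}`", whence `dim E_∞^{p,q} ≤ dim E_1^{p,q}` and, summing over `p + q = k` (the
filtration of `H^k` being finite), `dim H^k_dR(M; ℂ) = ∑ dim E_∞^{p,q} ≤ ∑ h^{p,q}`; the
`E_1`-terms are finite-dimensional for compact `M` by Cartan–Serre (`Literature.NumberTheory.Transcendental.finite_dolbeaultCohomology`),
which is what makes the `Module.finrank`s on the right meaningful.  Combined with de Rham's
theorem `dim_ℂ H^k_dR(M; ℂ) = b_k(M; ℂ)` (`Literature.NumberTheory.Transcendental.finrank_complexDeRham_eq_bettiNumber`) it gives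
the Frölicher inequality `bettiNumber_le_sum_hodgeNumber` (`bettiNumber_le_sum_hodgeNumber_of`).
Named fact (D-0014), instance hypotheses bound inside the `Prop`; usage
`(h : finrank_complexDeRham_le_sum_hodgeNumber E M)`.
[cite: VoisinHodgeI2002, §8.3.3, proof of Thm. 8.28, pp. 204–205] -/
def finrank_complexDeRham_le_sum_hodgeNumber : Prop :=
  ∀ [FiniteDimensional ℂ E] [IsManifold 𝓘(ℝ, E) ∞ M] [IsManifold 𝓘(ℂ, E) ω M]
    [CompactSpace M] [T2Space M] (k : ℕ),
    finrank ℂ (Literature.NumberTheory.Transcendental.complexDeRhamCohomology E M k) ≤ ∑ pq ∈ antidiagonal k, Literature.NumberTheory.Transcendental.hodgeNumber E M pq.1 pq.2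

omit [IsManifold 𝓘(ℂ, E) ω M] in
/-- The Frölicher inequality `bettiNumber_le_sum_hodgeNumber` follows from its analytic core
`finrank_complexDeRham_le_sum_hodgeNumber` (`dim H^k_dR(M; ℂ) ≤ ∑ h^{p,q}`, Voisin (2002),
pp. 204–205) and de Rham's theorem `dim_ℂ H^k_dR(M; ℂ) = b_k(M; ℂ)`
(`Literature.NumberTheory.Transcendental.finrank_complexDeRham_eq_bettiNumber`), the two named facts threaded as hypotheses
(compare `sum_hodgeNumber_eq_bettiNumber_of`).
[cite: VoisinHodgeI2002, §8.3.3, proof of Thm. 8.28 and Rem. 8.29, pp. 204–205] -/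
theorem bettiNumber_le_sum_hodgeNumber_of
    (hF : finrank_complexDeRham_le_sum_hodgeNumber E M)
    (hdR : ∀ k, Literature.NumberTheory.Transcendental.finrank_complexDeRham_eq_bettiNumber E M k) :
    bettiNumber_le_sum_hodgeNumber E M := by
  intro _ _ _ _ _ k
  rw [← show finrank ℂ (Literature.NumberTheory.Transcendental.complexDeRhamCohomology E M k) = Literature.AlgebraicTopology.SingularHomology.bettiNumber ℂ M k from hdR k]
  exact hF k

end Hodge

end Literature.AlgebraicGeometry.Motives
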